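import Summits.CriticalPhenomena.Ising3D.TaylorRegionDeltaLitOdd
import HarnessLib

/-!
# The literal-table γ-capstone: `TaylorTable.boxExcluded_of_taylorTable_dec_of_splitΔL`
(cell `pub-ising3x`, seat recog-1 gen 13; gate (g2))

HONEST FRAMING: lottery ticket; floor = tightest certified 3D Ising CFT bounds; no exact-solution
claim without a proof. Island framing: certified exclusion region at stated derivative order and
assumptions; not a determination of the 3D Ising critical exponents beyond that.

Glue of `taylorEvenRegion_of_splitΔL` (TaylorRegionDeltaLitEven) and `oddCone_of_splitΔL` (TaylorRegionDeltaLitOdd) to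
boot-1's `TaylorTable` (data `TaylorTable.evenDataΔ / oddDataΔ` of TaylorRegionDeltaCapstone): the all-Boolean
capstone whose every hypothesis after `h`, `he` is ONE small kernel declaration of a certificate file — the shape the
certificate-file generator `HOME/code/regioncert` (recog-1 gen 13) emits. Elementary. [folklore]
-/

namespace Summit.CriticalPhenomena.Ising3D

open Finset Set
open Literature.Analysis.ValidatedNumerics Literature.Analysis.ValidatedNumerics.PolyMP
open Literature.Analysis.ValidatedNumerics.NumericsMP (MI)
open Literature.MathematicalPhysics.QuantumFieldTheory.ConformalBootstrap3D

/-! ### `TaylorTable` glue and the literal-table capstone -/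

namespace TaylorTable

variable (T : TaylorTable)

/-- **The table's even region over its whole box from the literal-table Booleans.** [folklore] -/
theorem evenRegion_of_splitΔL (π : EvenRegionParamsΔ) (LP LT : IPoly2 × IPoly2 × IPoly2 × IPoly2)
    (TT : ITab3 × ITab3 × ITab3 × ITab3) (L : List (ITriple × ITriple × ITriple)) (B : List (List ℚ))
    (hl : (T.evenDataΔ π).l.Nodup) (hs : (T.evenDataΔ π).sizesOK = true) (hnX : 0 < (T.evenDataΔ π).prmX.nθ)
    (hnY : 0 < (T.evenDataΔ π).prmY.nθ) (hlen : (T.evenDataΔ π).tailLenOK LT = true)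
    (hPD : ∀ c : ℕ, c < 4 → (T.evenDataΔ π).pdLitOK LP c = true)
    (hmom : ∀ c r : ℕ, c < 4 → r < (T.evenDataΔ π).R → (T.evenDataΔ π).momRowLitOK LP LT c r = true)
    (hX : ∀ k : ℕ, k < (T.evenDataΔ π).prmX.nθ → (T.evenDataΔ π).tailXCellOKL LT k = true)
    (hY : ∀ k : ℕ, k < (T.evenDataΔ π).prmY.nθ → (T.evenDataΔ π).tailYCellOKL LT k = true)
    (hD : ∀ k : ℕ, k < (T.evenDataΔ π).prmD.nθ →
      (T.evenDataΔ π).toH.tailDCellOKL (EvenRegionDataΔ.tailLT LT) k = true)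
    (hT : ∀ c m : ℕ, c < 4 → m < 3 → (T.evenDataΔ π).tabOKc TT c m = true)
    (hr : ∀ j : ℕ, j < (T.evenDataΔ π).J1 + 1 → (T.evenDataΔ π).rowLitOKL TT L j = true)
    (hp : ∀ j k : ℕ, j < (T.evenDataΔ π).J1 + 1 → k < numPieces B j → (T.evenDataΔ π).pieceOKB L B j k = true) :
    TaylorEvenRegion T.α T.box ((T.E₀ : ℚ) : ℝ) :=
  taylorEvenRegion_of_splitΔL (T.evenDataΔ π) LP LT TT L B hl hs hnX hnY hlen hPD hmom hX hY hD hT hr hp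

/-- **The table's odd cone over its whole box from the literal-table Booleans.** [folklore] -/
theorem oddCone_of_splitΔL (π : OddConeParamsΔ) (LP LT : IPoly2x5) (TT : ITab3x5) (L : List OddLit)
    (B : List (List ℚ)) (hl : (T.oddDataΔ π).l.Nodup) (hlψ : (T.oddDataΔ π).lψ.Nodup)
    (ha : (T.oddDataΔ π).toCertH.atomsOK = true) (hs : (T.oddDataΔ π).sizesOK = true)
    (hprm : (T.oddDataΔ π).tailPrmOK = true) (hlen : (T.oddDataΔ π).tailLenOK LT = true)
    (hPD : ∀ c : ℕ, c < 5 → (T.oddDataΔ π).pdLitOK LP c = true)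
    (hmom : ∀ c r : ℕ, c < 5 → r < (T.oddDataΔ π).R → (T.oddDataΔ π).momRowLitOK LP LT c r = true)
    (hcell : ∀ leg k : ℕ, leg < 4 → k < ((T.oddDataΔ π).legPrm leg).nθ → (T.oddDataΔ π).tailCellOK LT leg k = true)
    (hT : ∀ c m : ℕ, c < 5 → m < 3 → (T.oddDataΔ π).tabOKc TT c m = true)
    (hr : ∀ j : ℕ, j < (T.oddDataΔ π).J1 + 1 → (T.oddDataΔ π).rowLitOKL TT L j = true)
    (hp : ∀ j k : ℕ, j < (T.oddDataΔ π).J1 + 1 → k < numPieces B j → (T.oddDataΔ π).pieceOKB L B j k = true) :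
    T.OddCone :=
  Summit.CriticalPhenomena.Ising3D.oddCone_of_splitΔL (T.oddDataΔ π) LP LT TT L B hl hlψ ha hs hprm hlen hPD hmom
    hcell hT hr hp

/-- **LITERAL-TABLE CAPSTONE**: table check, enclosure check, the even literal-table Booleans and the odd literal-table
Booleans ⇒ the box is excluded. Every hypothesis after `he` is kernel data meant to be ONE small `decide` declaration of a
certificate file (the `∀`-hypotheses: one declaration per index, assembled by `interval_cases`). [folklore] -/
theorem boxExcluded_of_taylorTable_dec_of_splitΔL (h : T.check = true) (he : T.checkEncl = true)
    (πE : EvenRegionParamsΔ) (LPE LTE : IPoly2 × IPoly2 × IPoly2 × IPoly2) (TTE : ITab3 × ITab3 × ITab3 × ITab3)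
    (LE : List (ITriple × ITriple × ITriple)) (BE : List (List ℚ)) (hlE : (T.evenDataΔ πE).l.Nodup)
    (hsE : (T.evenDataΔ πE).sizesOK = true) (hnX : 0 < (T.evenDataΔ πE).prmX.nθ) (hnY : 0 < (T.evenDataΔ πE).prmY.nθ)
    (hlenE : (T.evenDataΔ πE).tailLenOK LTE = true) (hPDE : ∀ c : ℕ, c < 4 → (T.evenDataΔ πE).pdLitOK LPE c = true)
    (hmomE : ∀ c r : ℕ, c < 4 → r < (T.evenDataΔ πE).R → (T.evenDataΔ πE).momRowLitOK LPE LTE c r = true)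
    (hX : ∀ k : ℕ, k < (T.evenDataΔ πE).prmX.nθ → (T.evenDataΔ πE).tailXCellOKL LTE k = true)
    (hY : ∀ k : ℕ, k < (T.evenDataΔ πE).prmY.nθ → (T.evenDataΔ πE).tailYCellOKL LTE k = true)
    (hD : ∀ k : ℕ, k < (T.evenDataΔ πE).prmD.nθ →
      (T.evenDataΔ πE).toH.tailDCellOKL (EvenRegionDataΔ.tailLT LTE) k = true)
    (hTE : ∀ c m : ℕ, c < 4 → m < 3 → (T.evenDataΔ πE).tabOKc TTE c m = true)
    (hrE : ∀ j : ℕ, j < (T.evenDataΔ πE).J1 + 1 → (T.evenDataΔ πE).rowLitOKL TTE LE j = true)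
    (hpE : ∀ j k : ℕ, j < (T.evenDataΔ πE).J1 + 1 → k < numPieces BE j → (T.evenDataΔ πE).pieceOKB LE BE j k = true)
    (πO : OddConeParamsΔ) (LPO LTO : IPoly2x5) (TTO : ITab3x5) (LO : List OddLit) (BO : List (List ℚ))
    (hlO : (T.oddDataΔ πO).l.Nodup) (hlψ : (T.oddDataΔ πO).lψ.Nodup) (haO : (T.oddDataΔ πO).toCertH.atomsOK = true)
    (hsO : (T.oddDataΔ πO).sizesOK = true) (hprmO : (T.oddDataΔ πO).tailPrmOK = true)
    (hlenO : (T.oddDataΔ πO).tailLenOK LTO = true) (hPDO : ∀ c : ℕ, c < 5 → (T.oddDataΔ πO).pdLitOK LPO c = true)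
    (hmomO : ∀ c r : ℕ, c < 5 → r < (T.oddDataΔ πO).R → (T.oddDataΔ πO).momRowLitOK LPO LTO c r = true)
    (hcellO : ∀ leg k : ℕ, leg < 4 → k < ((T.oddDataΔ πO).legPrm leg).nθ → (T.oddDataΔ πO).tailCellOK LTO leg k = true)
    (hTO : ∀ c m : ℕ, c < 5 → m < 3 → (T.oddDataΔ πO).tabOKc TTO c m = true)
    (hrO : ∀ j : ℕ, j < (T.oddDataΔ πO).J1 + 1 → (T.oddDataΔ πO).rowLitOKL TTO LO j = true)
    (hpO : ∀ j k : ℕ, j < (T.oddDataΔ πO).J1 + 1 → k < numPieces BO j → (T.oddDataΔ πO).pieceOKB LO BO j k = true) :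
    BoxExcluded T.box :=
  T.boxExcluded_of_taylorTable_dec h he
    (T.evenRegion_of_splitΔL πE LPE LTE TTE LE BE hlE hsE hnX hnY hlenE hPDE hmomE hX hY hD hTE hrE hpE)
    (T.oddCone_of_splitΔL πO LPO LTO TTO LO BO hlO hlψ haO hsO hprmO hlenO hPDO hmomO hcellO hTO hrO hpO)

end TaylorTable

end Summit.CriticalPhenomena.Ising3D
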